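import Summits.Ventures.HSemireg.WedgeHankelSubstitutionShearJordanBasis
import Summits.Ventures.HSemireg.WedgeHankelSubstitutionShearCentralizer

/-!
# Venture HSemireg — THE CENTRALIZER OF THE SHEAR ON TH-7's CLASSES IN CHARACTERISTIC `p`, ALSO FOR `p ≤ n`: an endomorphism commuting with `SbC(1 λ 0 1)` is determined by
# its values on the block starts `E_0, E_p, …, E_{p⌊n/p⌋}`, these values are free except `N^{n mod p + 1} φ(E_{p⌊n/p⌋}) = 0`, and
# `dim Centralizer = ⌊n/p⌋·(n + 1) + (⌊n/p⌋ + 1)·(n mod p + 1)` (`= Σ_{i,j} min(ℓ_i, ℓ_j)` over the Jordan blocks; `= n + 1` exactly when `p > n`, K13)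

HONEST FRAMING. Part of the Lean index of the computation cell `pub-hsemireg` (seat p10 gen 22, Sunday typer «UNIFORM-IN-n»).
Finite-dimensional EXTERIOR ALGEBRA + linear algebra ONLY: no variety, no cohomology theory, no sheaf, no Ext group, no semiregularity map;
nothing here says that HC / HC_CM / HC_AV holds; no Literature fact is declared or used.  Custodian versions as in `WedgeHankelSiegelIdeal` (1/3) and `WedgeHankelFrameChange`;
the dictionary (the shear = translation of the node; its commutant in `End(Sym^n)`) is QUOTED, never asserted.

WHAT IS IN THE TREE.  K13 (`WedgeHankelSubstitutionShearCentralizer`): `commute_shear_iff_commute_sub_one`, **`commute_shear_iff_mem_span_pow`** (`n!·λ ≠ 0`: the centralizer is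
`K[N]`, dimension `n + 1`); K21 (`WedgeHankelSubstitutionShearJordanBasis`): the Jordan basis `J_m = N^{m mod p} E_{p⌊m/p⌋}` (`linearIndependent_jordan`, `span_jordan_eq_top`), the
chains (`shear_sub_one_apply_jordan_of_lt`, `…_eq_zero_of_mod`, `…_eq_zero_of_eq`, `div_mod_add_of_lt`); K1 `finrank_range_SbC_shear_sub_one_pow_char`, J-leaf
`SbC_shear_sub_one_pow_char` (`N^p = 0`).  Gen 21 CLOSE §OPEN (d): the centralizer for `p ≤ n`.  THIS FILE (namespace `Summit.Ventures.HSemireg.Wedge.HankelFrameChange` continued;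
imports K21, K13):
* §316 the BLOCK STARTS `E_{pi}`, `i ≤ ⌊n/p⌋`: `mul_lt_succ_of_le_div`, `div_lt_succ_div`, `jordan_of_mod_eq_zero` (`J_m = E_m` when `p ∣ m`), **`apply_jordan_of_commute`**
  (`φ J_m = N^{m mod p} φ(E_{p⌊m/p⌋})` for `φ` commuting with `N`), **`eq_zero_of_commute_of_apply_block_start_eq_zero`** / **`eq_of_commute_of_apply_block_start_eq`** (such `φ` is determined by its values on the block starts),
  **`pow_apply_block_start_last_eq_zero`** (the constraint `N^{n mod p + 1} φ(E_{p⌊n/p⌋}) = 0`).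
* §317 **`exists_commute_of_block_targets`**: conversely every family of targets `g_i`, `i ≤ ⌊n/p⌋`, with `N^{n mod p + 1} g_{⌊n/p⌋} = 0` is realised by a unique `φ` commuting
  with `N` (`φ(J_m) := N^{m mod p} g_{⌊m/p⌋}` on the Jordan basis).
* §318 **`finrank_centralizer_shear_char`: `dim Subalgebra.centralizer {SbC(1 λ 0 1)} = ⌊n/p⌋·(n+1) + (⌊n/p⌋+1)·(n mod p + 1)`** (characteristic `p`, `λ ≠ 0`, every `n`; evaluation
  at the block starts is injective on the centralizer with image `{g : N^{n mod p+1} g_{⌊n/p⌋} = 0}`, of codimension `rank N^{n mod p + 1}` in `V^{⌊n/p⌋+1}`),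
  `finrank_centralizer_shear_char_of_lt` (`p > n`: `n + 1`, K13's count recovered), **`lt_finrank_centralizer_shear_char`** (`p ≤ n`: `> n + 1` — the centralizer is then
  STRICTLY BIGGER than `K[N]`), `finrank_centralizer_shear_char_self` (`n = p`: `p + 3`).
NOT typed here: the algebra structure of the centralizer (it is non-commutative for `p ≤ n`); parabolic substitutions (conjugate, K5); anything Ext-side.  New names only.
-/

open Module

namespace Summit.Ventures.HSemireg.Wedge.HankelFrameChange

open Summit.Ventures.HSemireg.Wedge Summit.Ventures.HSemireg.Wedge.Kunneth Summit.Ventures.HSemireg.Wedge.Hankel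
  Summit.Ventures.HSemireg.Wedge.BasisFree Summit.Ventures.HSemireg.Wedge.HankelSiegel Summit.Ventures.HSemireg.Wedge.HankelSiegelIdeal
  Summit.Ventures.HSemireg.Wedge.KunnethKernel Summit.Ventures.HSemireg.Wedge.HankelRankOne Summit.Ventures.HSemireg.Wedge.KernelDuality

variable (K : Type*) [Field K] {n : ℕ}

/-! ## §316. The block starts `E_0, E_p, …, E_{p⌊n/p⌋}` determine an endomorphism commuting with the shear -/

/-- the block starts are spikes: `p·i ≤ n` for `i ≤ ⌊n/p⌋`. -/
theorem mul_lt_succ_of_le_div (p : ℕ) (i : Fin (n / p + 1)) : p * (i : ℕ) < n + 1 :=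
  Nat.lt_succ_of_le (le_trans (Nat.mul_le_mul_left p (Nat.le_of_lt_succ i.2)) (Nat.mul_div_le n p))

/-- the block index of a spike: `⌊m/p⌋ ≤ ⌊n/p⌋`. -/
theorem div_lt_succ_div (p : ℕ) (m : Fin (n + 1)) : (m : ℕ) / p < n / p + 1 :=
  Nat.lt_succ_of_le (Nat.div_le_div_right (Nat.le_of_lt_succ m.2))

/-- **at a multiple of `p` the Jordan vector is the spike itself: `J_m = E_m` when `m mod p = 0`.** -/
theorem jordan_of_mod_eq_zero (lam : K) (p : ℕ) (m : Fin (n + 1)) (hm : (m : ℕ) % p = 0) :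
    ((SbC K 1 lam 0 1 - 1) ^ ((m : ℕ) % p)) (spikeBasis K n ⟨p * ((m : ℕ) / p), mul_div_lt_succ p m⟩) = spikeBasis K n m := by
  have hd : p * ((m : ℕ) / p) = (m : ℕ) := by have := Nat.div_add_mod (m : ℕ) p; omega
  have e : (⟨p * ((m : ℕ) / p), mul_div_lt_succ p m⟩ : Fin (n + 1)) = m := Fin.ext hd
  rw [hm, pow_zero, Module.End.one_apply, e]

/-- **an endomorphism commuting with `N = SbC(1 λ 0 1) − 1` satisfies `φ(J_m) = N^{m mod p} φ(E_{p⌊m/p⌋})`** (every field). -/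
theorem apply_jordan_of_commute (lam : K) (p : ℕ) {φ : spikeSpan K n →ₗ[K] spikeSpan K n} (hφ : φ * (SbC K 1 lam 0 1 - 1) = (SbC K 1 lam 0 1 - 1) * φ) (m : Fin (n + 1)) :
    φ (((SbC K 1 lam 0 1 - 1) ^ ((m : ℕ) % p)) (spikeBasis K n ⟨p * ((m : ℕ) / p), mul_div_lt_succ p m⟩)) =
      ((SbC K 1 lam 0 1 - 1) ^ ((m : ℕ) % p)) (φ (spikeBasis K n ⟨p * ((m : ℕ) / p), mul_div_lt_succ p m⟩)) := by
  have hc : Commute φ (SbC K 1 lam 0 1 - 1) := hφ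
  rw [← Module.End.mul_apply, (hc.pow_right _).eq, Module.End.mul_apply]

/-- **UNIQUENESS: an endomorphism commuting with the shear and vanishing on the block starts `E_0, E_p, …, E_{p⌊n/p⌋}` is zero** (characteristic `p`, `λ ≠ 0`: it vanishes on
the Jordan basis). -/
theorem eq_zero_of_commute_of_apply_block_start_eq_zero {lam : K} (hlam : lam ≠ 0) (p : ℕ) [Fact p.Prime] [CharP K p] {φ : spikeSpan K n →ₗ[K] spikeSpan K n}
    (hφ : φ * (SbC K 1 lam 0 1 - 1) = (SbC K 1 lam 0 1 - 1) * φ) (h0 : ∀ i : Fin (n / p + 1), φ (spikeBasis K n ⟨p * (i : ℕ), mul_lt_succ_of_le_div p i⟩) = 0) : φ = 0 := by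
  refine (Basis.mk (linearIndependent_jordan K hlam p) (span_jordan_eq_top K hlam p).ge).ext fun m => ?_
  rw [Basis.mk_apply, LinearMap.zero_apply, apply_jordan_of_commute K lam p hφ m,
    show φ (spikeBasis K n ⟨p * ((m : ℕ) / p), mul_div_lt_succ p m⟩) = 0 from h0 ⟨(m : ℕ) / p, div_lt_succ_div p m⟩, map_zero]

/-- **two endomorphisms commuting with the shear that agree on the block starts are equal** (characteristic `p`, `λ ≠ 0`). -/
theorem eq_of_commute_of_apply_block_start_eq {lam : K} (hlam : lam ≠ 0) (p : ℕ) [Fact p.Prime] [CharP K p] {φ ψ : spikeSpan K n →ₗ[K] spikeSpan K n}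
    (hφ : φ * (SbC K 1 lam 0 1 - 1) = (SbC K 1 lam 0 1 - 1) * φ) (hψ : ψ * (SbC K 1 lam 0 1 - 1) = (SbC K 1 lam 0 1 - 1) * ψ)
    (h : ∀ i : Fin (n / p + 1), φ (spikeBasis K n ⟨p * (i : ℕ), mul_lt_succ_of_le_div p i⟩) = ψ (spikeBasis K n ⟨p * (i : ℕ), mul_lt_succ_of_le_div p i⟩)) : φ = ψ := by
  refine (Basis.mk (linearIndependent_jordan K hlam p) (span_jordan_eq_top K hlam p).ge).ext fun m => ?_
  rw [Basis.mk_apply, apply_jordan_of_commute K lam p hφ m, apply_jordan_of_commute K lam p hψ m,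
    show φ (spikeBasis K n ⟨p * ((m : ℕ) / p), mul_div_lt_succ p m⟩) = ψ (spikeBasis K n ⟨p * ((m : ℕ) / p), mul_div_lt_succ p m⟩) from h ⟨(m : ℕ) / p, div_lt_succ_div p m⟩]

/-- **THE CONSTRAINT AT THE LAST BLOCK START: `N^{n mod p + 1} φ(E_{p⌊n/p⌋}) = 0`** for every `φ` commuting with `N` (`N^{n mod p + 1} E_{p⌊n/p⌋} = 0`: no spike beyond `E_n`). -/
theorem pow_apply_block_start_last_eq_zero (lam : K) (p : ℕ) {φ : spikeSpan K n →ₗ[K] spikeSpan K n} (hφ : φ * (SbC K 1 lam 0 1 - 1) = (SbC K 1 lam 0 1 - 1) * φ)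
    (h : p * (n / p) < n + 1) : ((SbC K 1 lam 0 1 - 1) ^ (n % p + 1)) (φ (spikeBasis K n ⟨p * (n / p), h⟩)) = 0 := by
  have hc : Commute φ (SbC K 1 lam 0 1 - 1) := hφ
  rw [← Module.End.mul_apply, ← (hc.pow_right _).eq, Module.End.mul_apply,
    SbC_shear_sub_one_pow_spikeBasis_eq_zero K lam (by simp only; have := Nat.div_add_mod n p; omega), map_zero]

/-! ## §317. Existence: prescribed values on the block starts -/

/-- **EXISTENCE: every family of targets `g_i ∈ V`, `i ≤ ⌊n/p⌋`, with `N^{n mod p + 1} g_{⌊n/p⌋} = 0` is the family of values on the block starts of an endomorphism commuting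
with the shear** (characteristic `p`, `λ ≠ 0`): define `φ(J_m) := N^{m mod p} g_{⌊m/p⌋}` on the Jordan basis; `φN = Nφ` holds on each `J_m` — inside a block both sides are
`N^{m mod p + 1} g_{⌊m/p⌋}`, at the end of a full block both vanish (`N^p = 0`), at `J_n` both vanish by the constraint. -/
theorem exists_commute_of_block_targets {lam : K} (hlam : lam ≠ 0) (p : ℕ) [Fact p.Prime] [CharP K p] (g : Fin (n / p + 1) → spikeSpan K n)
    (hg : ((SbC K 1 lam 0 1 - 1) ^ (n % p + 1)) (g (Fin.last (n / p))) = 0) :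
    ∃ φ : spikeSpan K n →ₗ[K] spikeSpan K n, φ * (SbC K 1 lam 0 1 - 1) = (SbC K 1 lam 0 1 - 1) * φ ∧
      ∀ i : Fin (n / p + 1), φ (spikeBasis K n ⟨p * (i : ℕ), mul_lt_succ_of_le_div p i⟩) = g i := by
  classical
  have hp : p.Prime := Fact.out
  let b : Basis (Fin (n + 1)) K (spikeSpan K n) := Basis.mk (linearIndependent_jordan K hlam p) (span_jordan_eq_top K hlam p).ge
  have hb : ∀ m : Fin (n + 1), b m = ((SbC K 1 lam 0 1 - 1) ^ ((m : ℕ) % p)) (spikeBasis K n ⟨p * ((m : ℕ) / p), mul_div_lt_succ p m⟩) := fun m => Basis.mk_apply _ _ m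
  let f : Fin (n + 1) → spikeSpan K n := fun m => ((SbC K 1 lam 0 1 - 1) ^ ((m : ℕ) % p)) (g ⟨(m : ℕ) / p, div_lt_succ_div p m⟩)
  have hf : ∀ m : Fin (n + 1), f m = ((SbC K 1 lam 0 1 - 1) ^ ((m : ℕ) % p)) (g ⟨(m : ℕ) / p, div_lt_succ_div p m⟩) := fun m => rfl
  refine ⟨b.constr K f, b.ext fun m => ?_, fun i => ?_⟩
  · rw [Module.End.mul_apply, Module.End.mul_apply, Basis.constr_basis]
    by_cases h1 : (m : ℕ) % p + 1 < p
    · by_cases h2 : (m : ℕ) < n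
      · -- inside a block: `N J_m = J_{m+1}`
        rw [hb, shear_sub_one_apply_jordan_of_lt K lam hp.pos m h1 h2, ← hb ⟨(m : ℕ) + 1, by omega⟩, Basis.constr_basis, hf, hf]
        obtain ⟨hd, hmod⟩ := div_mod_add_of_lt hp.pos h1
        have e : (⟨((⟨(m : ℕ) + 1, by omega⟩ : Fin (n + 1)) : ℕ) / p, div_lt_succ_div p _⟩ : Fin (n / p + 1)) = ⟨(m : ℕ) / p, div_lt_succ_div p m⟩ := Fin.ext hd
        rw [e, ← Module.End.mul_apply ((SbC K 1 lam 0 1 - 1)), ← pow_succ']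
        simp only [hmod]
      · -- `m = n`: `N J_n = 0`, and `N^{n mod p + 1} g_{⌊n/p⌋} = 0`
        have hmn : (m : ℕ) = n := by have := m.2; omega
        rw [hb, shear_sub_one_apply_jordan_eq_zero_of_eq K lam p m hmn, map_zero, hf, ← Module.End.mul_apply ((SbC K 1 lam 0 1 - 1)), ← pow_succ']
        have e : (⟨(m : ℕ) / p, div_lt_succ_div p m⟩ : Fin (n / p + 1)) = Fin.last (n / p) := Fin.ext (by rw [Fin.val_last]; simp only [hmn])
        rw [e]
        simp only [hmn]
        exact hg.symm
    · -- end of a full block: `N J_m = 0` and `N^p = 0`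
      have h1' : (m : ℕ) % p + 1 = p := by have := Nat.mod_lt (m : ℕ) hp.pos; omega
      rw [hb, shear_sub_one_apply_jordan_eq_zero_of_mod K lam p m h1', map_zero, hf, ← Module.End.mul_apply ((SbC K 1 lam 0 1 - 1)), ← pow_succ', h1',
        SbC_shear_sub_one_pow_char K lam p, LinearMap.zero_apply]
  · -- the value at the block start `E_{pi} = J_{pi}`
    rw [← jordan_of_mod_eq_zero K lam p ⟨p * (i : ℕ), mul_lt_succ_of_le_div p i⟩ (Nat.mul_mod_right p i), ← hb, Basis.constr_basis, hf]
    have e : (⟨((⟨p * (i : ℕ), mul_lt_succ_of_le_div p i⟩ : Fin (n + 1)) : ℕ) / p, div_lt_succ_div p _⟩ : Fin (n / p + 1)) = i := Fin.ext (Nat.mul_div_cancel_left _ hp.pos)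
    rw [e]
    simp only [Nat.mul_mod_right, pow_zero, Module.End.one_apply]

/-! ## §318. The dimension of the centralizer -/

/-- membership in the centralizer subalgebra of the shear is commuting with `N = SbC(1 λ 0 1) − 1`. -/
theorem mem_centralizer_shear_iff (lam : K) (φ : Module.End K (spikeSpan K n)) :
    φ ∈ Subalgebra.centralizer K ({SbC K 1 lam 0 1} : Set (Module.End K (spikeSpan K n))) ↔ φ * (SbC K 1 lam 0 1 - 1) = (SbC K 1 lam 0 1 - 1) * φ := by
  rw [Subalgebra.mem_centralizer_iff, ← commute_shear_iff_commute_sub_one]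
  simp only [Set.mem_singleton_iff, forall_eq]
  exact eq_comm

/-- **THE DIMENSION OF THE CENTRALIZER OF THE SHEAR IN CHARACTERISTIC `p` (`λ ≠ 0`, every `n`):
`dim Centralizer(SbC(1 λ 0 1)) = ⌊n/p⌋·(n + 1) + (⌊n/p⌋ + 1)·(n mod p + 1)`** (`= Σ_{i,j} min(ℓ_i, ℓ_j)` over the Jordan blocks `ℓ = (p, …, p, n mod p + 1)`): evaluation at the
block starts embeds the centralizer into `V^{⌊n/p⌋+1}` with image `{g : N^{n mod p + 1} g_{⌊n/p⌋} = 0}`, of codimension `rank N^{n mod p + 1} = n + 1 − (⌊n/p⌋+1)(n mod p + 1)`. -/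
theorem finrank_centralizer_shear_char {lam : K} (hlam : lam ≠ 0) (p : ℕ) [Fact p.Prime] [CharP K p] :
    finrank K ↥(Subalgebra.centralizer K ({SbC K 1 lam 0 1} : Set (Module.End K (spikeSpan K n)))) = n / p * (n + 1) + (n / p + 1) * (n % p + 1) := by
  classical
  have hp : p.Prime := Fact.out
  rw [← Subalgebra.finrank_toSubmodule]
  -- evaluation at the block starts, restricted to the centralizer
  let ev : Module.End K (spikeSpan K n) →ₗ[K] (Fin (n / p + 1) → spikeSpan K n) :=
    LinearMap.pi fun i : Fin (n / p + 1) => LinearMap.applyₗ (spikeBasis K n ⟨p * (i : ℕ), mul_lt_succ_of_le_div p i⟩)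
  have hev : ∀ (φ : Module.End K (spikeSpan K n)) (i : Fin (n / p + 1)), ev φ i = φ (spikeBasis K n ⟨p * (i : ℕ), mul_lt_succ_of_le_div p i⟩) := fun φ i => rfl
  let C := Subalgebra.toSubmodule (Subalgebra.centralizer K ({SbC K 1 lam 0 1} : Set (Module.End K (spikeSpan K n))))
  have hC : ∀ φ : Module.End K (spikeSpan K n), φ ∈ C ↔ φ * (SbC K 1 lam 0 1 - 1) = (SbC K 1 lam 0 1 - 1) * φ := fun φ => by
    rw [Subalgebra.mem_toSubmodule, mem_centralizer_shear_iff]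
  let evC : ↥C →ₗ[K] (Fin (n / p + 1) → spikeSpan K n) := ev ∘ₗ C.subtype
  have hevC : ∀ (x : ↥C) (i : Fin (n / p + 1)), evC x i = (x : Module.End K (spikeSpan K n)) (spikeBasis K n ⟨p * (i : ℕ), mul_lt_succ_of_le_div p i⟩) := fun x i => rfl
  -- the constraint map `g ↦ N^{n mod p + 1} g_{⌊n/p⌋}`
  let Ψ : (Fin (n / p + 1) → spikeSpan K n) →ₗ[K] spikeSpan K n := ((SbC K 1 lam 0 1 - 1) ^ (n % p + 1)) ∘ₗ LinearMap.proj (Fin.last (n / p))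
  have hΨ : ∀ g : Fin (n / p + 1) → spikeSpan K n, Ψ g = ((SbC K 1 lam 0 1 - 1) ^ (n % p + 1)) (g (Fin.last (n / p))) := fun g => rfl
  -- (1) uniqueness: `evC` is injective on the centralizer
  have hinj : Function.Injective evC := fun x y hxy =>
    Subtype.ext (eq_of_commute_of_apply_block_start_eq K hlam p ((hC _).mp x.2) ((hC _).mp y.2) fun i => by rw [← hevC, ← hevC, hxy])
  -- (2) the image lies in the kernel of the constraint …
  have hcod : ∀ x : ↥C, evC x ∈ LinearMap.ker Ψ := fun x => by
    rw [LinearMap.mem_ker, hΨ, hevC]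
    have e : (⟨p * ((Fin.last (n / p) : Fin (n / p + 1)) : ℕ), mul_lt_succ_of_le_div p _⟩ : Fin (n + 1)) = ⟨p * (n / p), by have := Nat.mul_div_le n p; omega⟩ :=
      Fin.ext (by simp only [Fin.val_last])
    rw [e]
    exact pow_apply_block_start_last_eq_zero K lam p ((hC _).mp x.2) _
  -- … and exhausts it (existence)
  have hsurj : Function.Surjective (LinearMap.codRestrict (LinearMap.ker Ψ) evC hcod) := by
    rintro ⟨g, hg0⟩
    rw [LinearMap.mem_ker, hΨ] at hg0
    obtain ⟨φ, hφ, hφg⟩ := exists_commute_of_block_targets K hlam p g hg0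
    exact ⟨⟨φ, (hC φ).mpr hφ⟩, Subtype.ext (funext fun i => by rw [LinearMap.codRestrict_apply, hevC]; exact hφg i)⟩
  have hbij : Function.Bijective (LinearMap.codRestrict (LinearMap.ker Ψ) evC hcod) :=
    ⟨fun x y hxy => hinj (congrArg Subtype.val hxy), hsurj⟩
  -- (3) dimensions
  have h1 : finrank K ↥C = finrank K ↥(LinearMap.ker Ψ) := (LinearEquiv.ofBijective _ hbij).finrank_eq
  have h2 := LinearMap.finrank_range_add_finrank_ker Ψ
  have h3 : LinearMap.range Ψ = LinearMap.range ((SbC K 1 lam 0 1 (n := n) - 1) ^ (n % p + 1)) :=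
    LinearMap.range_comp_of_range_eq_top _ (LinearMap.range_eq_top.mpr (LinearMap.proj_surjective (Fin.last (n / p))))
  have h4 := finrank_range_SbC_shear_sub_one_pow_char K hlam p (n % p + 1) (n := n)
  have h5 : finrank K (Fin (n / p + 1) → spikeSpan K n) = (n / p + 1) * (n + 1) := by
    rw [finrank_eq_card_basis (Pi.basis fun _ : Fin (n / p + 1) => spikeBasis K n), Fintype.card_sigma, Finset.sum_const, Finset.card_univ, Fintype.card_fin,
      Fintype.card_fin, smul_eq_mul]
  have hmin1 : min (n % p + 1) p = n % p + 1 := min_eq_left (Nat.mod_lt n hp.pos)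
  rw [hmin1, min_self] at h4
  rw [h3, h5] at h2
  have e1 : (n / p + 1) * (n + 1) = n / p * (n + 1) + (n + 1) := by ring
  have e2 : (n / p + 1) * (n % p + 1) = n / p * (n % p + 1) + (n % p + 1) := by ring
  rw [e1] at h2
  rw [e2]
  show finrank K ↥C = _
  omega

/-- `p > n` (`⌊n/p⌋ = 0`): the centralizer has dimension `n + 1` (K13's `K[N]`, recovered by the count). -/
theorem finrank_centralizer_shear_char_of_lt {lam : K} (hlam : lam ≠ 0) (p : ℕ) [Fact p.Prime] [CharP K p] (hpn : n < p) :
    finrank K ↥(Subalgebra.centralizer K ({SbC K 1 lam 0 1} : Set (Module.End K (spikeSpan K n)))) = n + 1 := by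
  rw [finrank_centralizer_shear_char K hlam p, Nat.div_eq_of_lt hpn, Nat.mod_eq_of_lt hpn, zero_mul, zero_add, zero_add, one_mul]

/-- **`p ≤ n`: the centralizer is STRICTLY BIGGER than `K[N]` — its dimension exceeds `n + 1`** (there are `⌊n/p⌋ ≥ 1` full blocks besides the short one). -/
theorem lt_finrank_centralizer_shear_char {lam : K} (hlam : lam ≠ 0) (p : ℕ) [Fact p.Prime] [CharP K p] (hpn : p ≤ n) :
    n + 1 < finrank K ↥(Subalgebra.centralizer K ({SbC K 1 lam 0 1} : Set (Module.End K (spikeSpan K n)))) := by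
  have hp : p.Prime := Fact.out
  rw [finrank_centralizer_shear_char K hlam p]
  have hq : 1 ≤ n / p := (Nat.le_div_iff_mul_le hp.pos).mpr (by rwa [one_mul])
  have h1 := Nat.mul_le_mul_right (n + 1) hq
  have e2 : (n / p + 1) * (n % p + 1) = n / p * (n % p + 1) + (n % p + 1) := by ring
  rw [e2]
  omega

/-- `n = p`: Jordan type `(p, 1)`, centralizer of dimension `p + 3`. -/
theorem finrank_centralizer_shear_char_self {lam : K} (hlam : lam ≠ 0) (p : ℕ) [Fact p.Prime] [CharP K p] (hn : n = p) :
    finrank K ↥(Subalgebra.centralizer K ({SbC K 1 lam 0 1} : Set (Module.End K (spikeSpan K n)))) = p + 3 := by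
  have hp : p.Prime := Fact.out
  rw [finrank_centralizer_shear_char K hlam p, hn, Nat.div_self hp.pos, Nat.mod_self]
  ring

end Summit.Ventures.HSemireg.Wedge.HankelFrameChange
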